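import Summits.QuantumFields.BalabanUV.Beta.ChartConjugationRelative
import Summits.QuantumFields.BalabanUV.Beta.DecayingKernelNeumann
import Literature.MathematicalPhysics.QuantumFieldTheory.Balaban1983to89.Beta.HessKerDressedLimit

/-!
# `BalabanUV.Beta.FP.LetterInheritance` — road «FP» for binder row D1, row N3-fine ∕ N3(ii)–(iv) («Ward tower limits»), GENERIC PART: THE
# THREE LETTERS OF `FP/PerfectFineWard` — relative-inverse structure (K), block-stencil Ward law (S), second-order law (W2♮) with a
# tadpole-null remainder (W) — PASS FROM FINITE `j` TO THE LIMIT under geometric `Decays`-rate data (the cell's (CONV-C)-type currency)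

HONEST DEPENDENCY (page 1, mandatory): continuum YM on T⁴ ⇐ BetaPertH ∧ nine spine estimates (0/9 proved); BetaPertH ⇐ (D1) ∧ (D4) ∧
CAP+tail; G-an2-4 gates asym, D1 and NE2/3/4.  HONEST FRAMING (cell contract, verbatim): «discharging `BetaPertH` makes Bałaban's UV
stability UNCONDITIONAL — a real constructive-QFT result; it is NOT the continuum limit and NOT the Clay problem.»  [folklore] rate
bookkeeping over the UNMODIFIED words of an2's `ExpKernelCalculus` (`comp`, `tr`, `tadpole`, `Decays`, `BiLoc`), an2/an5's `ChartConjugation(Relative)`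
(`conjV`, `conjW`, `RelInv`), `KernelWard.divV`, BY NAME over `BalabanStepJetsSucc.decays_comp`, `TameKernelCalculus.comp_sub_left∕right_tame`,
`HessKerRate.decays_sub` ∕ `abs_tadpole_sub_le`, `HessKerDressedLimit.tendsto_of_decays_rate`, `DecayingKernelNeumann.decays_congr_const`.  No definition, no `def … : Prop`, nothing cited, 0 sorry; every rate ∕ bound is a HYPOTHESIS; no perfect object of road FP is touched (the
instantiation at `KPerf` ∕ `SPerfOf` against the (j,m) families of record is the next cut, owner's R-FP-8 bookkeeping); 0∕4 binders of row D1;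
NOT the letters, NOT hrep, NOT D1, NOT BetaPertH, NOT continuum, NOT Clay.  ABSOLUTE RULE (cell charter, verbatim): «No internally-minted
statement may enter as a cited fact. Every hypothesis is either kernel-proved in this package or a verbatim quotation of a PUBLISHED theorem
with page reference. The manuscript(s) under audit are NOT citable for their own disputed steps — they are the thing under adjudication;
programme-internal (2001/route/tribunal) claims are never citable.»

WHY.  `FP/PerfectFineWard` ∕ `FP/PerfectFineWardSeam` reduce both Ward inputs of road FP's REP∞ chain (`hrow`, and with leaf-02's
`PerfectSandwichWard` also `hT1`) to three LETTERS at the perfect family: (K) `RelInv (Π K_perf Π) 𝕄 E`, (S) `cH • Σ_{v∈box} divV S (n•y + v) =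
conjV 𝕄 (Xc y)`, (W) `divW Wf u ν u′ = conjW 𝕄 0 (Πᵀ S ν u′) (X′ u) 0 (X₂ u ν u′) + N u ν u′` with `tadpole (Π K_perf Π) (N …) = 0`.  Their
finite-`j` instances are tree theorems about the wall family (leaf-10's `WardLocusRecursive.hSd_SrecAt`, an3's `E3CoDressedContactLevelOne.relInv_coDress`,
an1's table laws); the perfect objects are `j → ∞` limits at geometric `Decays`-rates (`HessKerDressedLimit`, gan24's slot rows, `FP/SymmetryK`).
THIS FILE is the generic bridge: each letter's SHAPE is closed under such limits.

CONTENT (all [folklore]; any dimension `D`, finite fibre `F`).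
* §1 RATE CALCULUS OF `comp` IN THE `Decays` CURRENCY: `decays_add`, `decays_of_biLoc'` (a bi-localised letter decays: constant `|C|·e^{δ|p−q|₁}`),
  `spr_of_decays'`, `decays_of_rate_left` ∕ `decays_lim_of_rate`, **`decays_rate_comp`** (`A_j∘B_j − A∞∘B∞` decays with
  constant `|F|·(CA·cB + cA·CB)·Zl(δ/2)·θ^j` at rate `δ/2`), `decays_comp_half`, **`tendsto_comp_of_rate`**, `decays_rate_sub∕add∕const`,
  `decays_rate_of_le`, **`tendsto_comp₃_of_rate`** (triple compositions), **`eq_of_tendsto_of_eq`** (equality at every `j` + entrywise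
  convergence of both sides ⟹ equality of the limits).
* §2 LETTER INHERITANCE: **`relInv_of_rate`** ((K): `RelInv (A j) (M j) E ∀ j` ⟹ `RelInv A∞ M∞ E`); `tendsto_conjV_of_rate`, **`law_conjV_of_rate`**,
  `tendsto_divV`, `tendsto_smul_sum_divV`, **`blockWard_of_rate`** ((S): `c j • Σ_{v∈T} divV (S j) (w v) = conjV (M j) (X j) ∀ j` ⟹ the same for the
  limits — entrywise stencil convergence, `c j → c∞`, rate data for `M`, `X`); `lipT_mul`, **`tadpoleNull_of_rate`** (`tadpole (A j) (N j) = 0 ∀ j`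
  ⟹ `tadpole A∞ N∞ = 0`, via `HessKerRate.abs_tadpole_sub_le` and `θ^j → 0`); `tendsto_conjW_of_rate` (nine `comp` words, four of them triple),
  **`law_conjW_of_rate`** ((W): `L j = conjW (M j) (V j) (V′ j) (X j) (X′ j) (X₂ j) + N j ∀ j` ⟹ the same for the limits).
NOT HERE: the rate data themselves (hypotheses); any perfect object; any estimate beyond the displayed Lipschitz bookkeeping.
Unit `b2b-balaban-beta-d1-formalise-leaf-01` (gen 5), 2026-08-20; claim table `HOME/b2b-balaban-beta-d1-p3/LEAVES-FP.md` (N3-fine-REL ∕ N3(ii)–(iv)).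
-/

noncomputable section

namespace Summit.QuantumFields.BalabanUV.Beta.FP.LetterInheritance

open Finset Filter Topology
open scoped BigOperators
open Literature.MathematicalPhysics.QuantumFieldTheory.Balaban1983to89
open Literature.MathematicalPhysics.QuantumFieldTheory.Balaban1983to89.Beta
open B12Sec2to5 (l1 l1_nonneg)
open ExpKernelCalculus (MKer Decays BiLoc comp tr tadpole Zl Zl_nonneg)
open BalabanStepJetsSucc (decays_comp)
open HessKerDressedLimit (tendsto_of_decays_rate mker_sub_apply)
open Summit.QuantumFields.BalabanUV.Beta.TameKernelCalculus
open Summit.QuantumFields.BalabanUV.Beta.ChartConjugation (conjV conjW conjW₁ conjW₂)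
open Summit.QuantumFields.BalabanUV.Beta.ChartConjugationRelative (RelInv)
open Summit.QuantumFields.BalabanUV.Beta.DecayingKernelNeumann (decays_congr_const)

variable {D : ℕ} {F : Type*} [Fintype F]

/-! ## §1 Rate calculus of `comp` in the `Decays` currency -/

section Rate

omit [Fintype F] in
/-- [folklore] Sum of two decaying kernels. -/
theorem decays_add {A B : MKer D F} {CA CB δ : ℝ} (hA : Decays A CA δ) (hB : Decays B CB δ) : Decays (A + B) (CA + CB) δ := by
  intro x y a b
  rw [Pi.add_apply, Pi.add_apply, Pi.add_apply, Pi.add_apply, add_mul]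
  exact (abs_add_le _ _).trans (add_le_add (hA x y a b) (hB x y a b))

omit [Fintype F] in
/-- [folklore] A kernel bi-localised at `(p, q)` (rate `δ ≥ 0`) decays at the same rate with constant `|C|·e^{δ|p−q|₁}`. -/
theorem decays_of_biLoc' {K : MKer D F} {p q : Fin D → ℤ} {C δ : ℝ} (h : BiLoc K p q C δ) (hδ : 0 ≤ δ) :
    Decays K (|C| * Real.exp (δ * l1 (p - q))) δ := by
  intro x y a b
  refine (h x y a b).trans ?_
  have h3 : l1 (x - y) ≤ l1 (x - p) + l1 (p - q) + l1 (y - q) := by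
    have h1 := ExpKernelCalculus.l1_sub_triangle x p y
    have h2 := ExpKernelCalculus.l1_sub_triangle p q y
    rw [ExpKernelCalculus.l1_sub_symm q y] at h2
    linarith
  calc C * Real.exp (-δ * (l1 (x - p) + l1 (y - q))) ≤ |C| * Real.exp (-δ * (l1 (x - p) + l1 (y - q))) :=
        mul_le_mul_of_nonneg_right (le_abs_self C) (Real.exp_pos _).le
    _ ≤ |C| * (Real.exp (δ * l1 (p - q)) * Real.exp (-δ * l1 (x - y))) := by
        refine mul_le_mul_of_nonneg_left ?_ (abs_nonneg C)
        rw [← Real.exp_add]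
        exact Real.exp_le_exp.2 (by nlinarith)
    _ = |C| * Real.exp (δ * l1 (p - q)) * Real.exp (-δ * l1 (x - y)) := by ring

omit [Fintype F] in
/-- [folklore] A decaying kernel at a positive rate is spread (hence tame). -/
theorem spr_of_decays' {A : MKer D F} {C δ : ℝ} (hA : Decays A C δ) (hδ : 0 < δ) : Spr A := ⟨C, δ, hδ, hA⟩

omit [Fintype F] in
/-- [folklore] Uniform bound of the members from the limit's bound and the rate: `Decays (B j) (CB + cB·θ^j) δ`. -/
theorem decays_of_rate_left {B : ℕ → MKer D F} {Binf : MKer D F} {CB cB δ θ : ℝ} (hBinf : Decays Binf CB δ)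
    (hBr : ∀ j, Decays (B j - Binf) (cB * θ ^ j) δ) (j : ℕ) : Decays (B j) (cB * θ ^ j + CB) δ := by
  have h := decays_add (hBr j) hBinf
  rwa [sub_add_cancel] at h

omit [Fintype F] in
/-- [folklore] The limit's bound from a member's bound and the rate: `Decays Ainf (CA + cA·θ^j) δ`. -/
theorem decays_lim_of_rate {A : ℕ → MKer D F} {Ainf : MKer D F} {CA cA δ θ : ℝ} (hA : ∀ j, Decays (A j) CA δ)
    (hAr : ∀ j, Decays (A j - Ainf) (cA * θ ^ j) δ) (j : ℕ) : Decays Ainf (CA + cA * θ ^ j) δ := by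
  have h := HessKerRate.decays_sub (hA j) (hAr j)
  rwa [sub_sub_cancel] at h

/-- [folklore] **THE RATE OF A COMPOSITION.**  If `A j → A∞` and `B j → B∞` at geometric `Decays`-rates (`cA θ^j`, `cB θ^j`, rate `δ > 0`) with
uniform bounds `Decays (A j) CA δ` and `Decays B∞ CB δ`, then `comp (A j) (B j) → comp A∞ B∞` at the `Decays`-rate
`|F|·(CA·cB + cA·CB)·Zl(δ/2)·θ^j`, rate `δ/2` (telescoping `A_j∘(B_j − B∞) + (A_j − A∞)∘B∞`, `BalabanStepJetsSucc.decays_comp`). -/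
theorem decays_rate_comp {A B : ℕ → MKer D F} {Ainf Binf : MKer D F} {CA CB cA cB δ θ : ℝ}
    (hA : ∀ j, Decays (A j) CA δ) (hBinf : Decays Binf CB δ)
    (hAr : ∀ j, Decays (A j - Ainf) (cA * θ ^ j) δ) (hBr : ∀ j, Decays (B j - Binf) (cB * θ ^ j) δ) (hδ : 0 < δ) (j : ℕ) :
    Decays (comp (A j) (B j) - comp Ainf Binf)
      ((Fintype.card F : ℝ) * (CA * cB + cA * CB) * Zl D (δ / 2) * θ ^ j) (δ / 2) := by
  have hδ2 : 0 ≤ δ / 2 := by linarith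
  have hδ2' : δ / 2 < δ := by linarith
  have tA : Tame (A j) := (spr_of_decays' (hA j) hδ).tame
  have tAinf : Tame Ainf := (spr_of_decays' (decays_lim_of_rate hA hAr j) hδ).tame
  have tAd : Tame (A j - Ainf) := (spr_of_decays' (hAr j) hδ).tame
  have tB : Tame (B j) := (spr_of_decays' (decays_of_rate_left hBinf hBr j) hδ).tame
  have tBinf : Tame Binf := (spr_of_decays' hBinf hδ).tame
  have tBd : Tame (B j - Binf) := (spr_of_decays' (hBr j) hδ).tame
  have e : comp (A j) (B j) - comp Ainf Binf = comp (A j) (B j - Binf) + comp (A j - Ainf) Binf := by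
    rw [comp_sub_right_tame tA tB tBinf, comp_sub_left_tame tA tAinf tBinf]
    abel
  rw [e]
  have h1 := decays_comp (hA j) (hBr j) hδ2 hδ2'
  have h2 := decays_comp (hAr j) hBinf hδ2 hδ2'
  have hδe : δ - δ / 2 = δ / 2 := by ring
  rw [hδe] at h1 h2
  exact decays_congr_const (decays_add h1 h2) (by ring)

/-- [folklore] Uniform `Decays` bound of a composition of uniformly decaying families (rate `δ/2`). -/
theorem decays_comp_half {A B : MKer D F} {CA CB δ : ℝ} (hA : Decays A CA δ) (hB : Decays B CB δ) (hδ : 0 < δ) :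
    Decays (comp A B) ((Fintype.card F : ℝ) * (CA * CB) * Zl D (δ / 2)) (δ / 2) := by
  have h := decays_comp hA hB (by linarith : 0 ≤ δ / 2) (by linarith : δ / 2 < δ)
  have hδe : δ - δ / 2 = δ / 2 := by ring
  rwa [hδe] at h

/-- [folklore] **ENTRYWISE CONVERGENCE OF A COMPOSITION** from the rate data (`0 ≤ θ < 1`). -/
theorem tendsto_comp_of_rate {A B : ℕ → MKer D F} {Ainf Binf : MKer D F} {CA CB cA cB δ θ : ℝ}
    (hA : ∀ j, Decays (A j) CA δ) (hBinf : Decays Binf CB δ)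
    (hAr : ∀ j, Decays (A j - Ainf) (cA * θ ^ j) δ) (hBr : ∀ j, Decays (B j - Binf) (cB * θ ^ j) δ) (hδ : 0 < δ)
    (hθ0 : 0 ≤ θ) (hθ1 : θ < 1) (x y : Fin D → ℤ) (a b : F) :
    Tendsto (fun j => comp (A j) (B j) x y a b) atTop (𝓝 (comp Ainf Binf x y a b)) :=
  tendsto_of_decays_rate (decays_rate_comp hA hBinf hAr hBr hδ) hθ0 hθ1 x y a b

omit [Fintype F] in
/-- [folklore] Rate data passes to differences. -/
theorem decays_rate_sub {A B : ℕ → MKer D F} {Ainf Binf : MKer D F} {cA cB δ θ : ℝ}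
    (hAr : ∀ j, Decays (A j - Ainf) (cA * θ ^ j) δ) (hBr : ∀ j, Decays (B j - Binf) (cB * θ ^ j) δ) (j : ℕ) :
    Decays ((A j - B j) - (Ainf - Binf)) ((cA + cB) * θ ^ j) δ := by
  have h := HessKerRate.decays_sub (hAr j) (hBr j)
  have e : A j - Ainf - (B j - Binf) = (A j - B j) - (Ainf - Binf) := by abel
  rw [e] at h
  exact decays_congr_const h (by ring)

omit [Fintype F] in
/-- [folklore] Rate data passes to sums. -/
theorem decays_rate_add {A B : ℕ → MKer D F} {Ainf Binf : MKer D F} {cA cB δ θ : ℝ}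
    (hAr : ∀ j, Decays (A j - Ainf) (cA * θ ^ j) δ) (hBr : ∀ j, Decays (B j - Binf) (cB * θ ^ j) δ) (j : ℕ) :
    Decays ((A j + B j) - (Ainf + Binf)) ((cA + cB) * θ ^ j) δ := by
  have h := decays_add (hAr j) (hBr j)
  have e : A j - Ainf + (B j - Binf) = (A j + B j) - (Ainf + Binf) := by abel
  rw [e] at h
  exact decays_congr_const h (by ring)

omit [Fintype F] in
/-- [folklore] A constant family has rate data with constant `0`. -/
theorem decays_rate_const (E : MKer D F) (δ θ : ℝ) (j : ℕ) : Decays ((fun _ : ℕ => E) j - E) (0 * θ ^ j) δ := by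
  intro x y a b
  simp only [sub_self, Pi.zero_apply, abs_zero, zero_mul, le_refl]

omit [Fintype F] in
/-- [folklore] **EQUALITY PASSES TO THE LIMIT**: two families equal at every `j`, each converging entrywise, have equal limits. -/
theorem eq_of_tendsto_of_eq {K L : ℕ → MKer D F} {Kinf Linf : MKer D F} (h : ∀ j, K j = L j)
    (hK : ∀ x y a b, Tendsto (fun j => K j x y a b) atTop (𝓝 (Kinf x y a b)))
    (hL : ∀ x y a b, Tendsto (fun j => L j x y a b) atTop (𝓝 (Linf x y a b))) : Kinf = Linf := by
  funext x y a b
  exact tendsto_nhds_unique (hK x y a b) ((hL x y a b).congr fun j => by rw [h j])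

omit [Fintype F] in
/-- [folklore] Rate data at a smaller rate (`0 ≤ θ`): constant `|c|`. -/
theorem decays_rate_of_le {A : ℕ → MKer D F} {Ainf : MKer D F} {c δ δ' θ : ℝ} (h : ∀ j, Decays (A j - Ainf) (c * θ ^ j) δ)
    (hθ0 : 0 ≤ θ) (hle : δ' ≤ δ) (j : ℕ) : Decays (A j - Ainf) (|c| * θ ^ j) δ' := by
  have h1 := decays_of_le (h j) hle
  rwa [abs_mul, abs_pow, abs_of_nonneg hθ0] at h1

/-- [folklore] **ENTRYWISE CONVERGENCE OF A TRIPLE COMPOSITION** `comp (comp (X j) (Y j)) (Z j) → comp (comp X∞ Y∞) Z∞` from rate data of the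
three letters (all at rate `δ`; `0 ≤ θ < 1`). -/
theorem tendsto_comp₃_of_rate {X Y Z : ℕ → MKer D F} {Xinf Yinf Zinf : MKer D F} {CX CY CZ CYi CZi cX cY cZ δ θ : ℝ}
    (hX : ∀ j, Decays (X j) CX δ) (hY : ∀ j, Decays (Y j) CY δ) (hZ : ∀ j, Decays (Z j) CZ δ)
    (hYinf : Decays Yinf CYi δ) (hZinf : Decays Zinf CZi δ)
    (hXr : ∀ j, Decays (X j - Xinf) (cX * θ ^ j) δ) (hYr : ∀ j, Decays (Y j - Yinf) (cY * θ ^ j) δ)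
    (hZr : ∀ j, Decays (Z j - Zinf) (cZ * θ ^ j) δ) (hδ : 0 < δ) (hθ0 : 0 ≤ θ) (hθ1 : θ < 1) (x y : Fin D → ℤ) (a b : F) :
    Tendsto (fun j => comp (comp (X j) (Y j)) (Z j) x y a b) atTop (𝓝 (comp (comp Xinf Yinf) Zinf x y a b)) := by
  have hδ2 : 0 < δ / 2 := by linarith
  have hle : δ / 2 ≤ δ := by linarith
  have _hZ' := hZ  -- uniform member bound of `Z` is not needed below (only the limit's); kept in the signature for symmetry of use
  exact tendsto_comp_of_rate (A := fun j => comp (X j) (Y j)) (B := Z) (fun j => decays_comp_half (hX j) (hY j) hδ)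
    (decays_of_le hZinf hle) (decays_rate_comp hX hYinf hXr hYr hδ) (decays_rate_of_le hZr hθ0 hle) hδ2 hθ0 hθ1 x y a b

end Rate

/-! ## §2 Letter inheritance: relative inverse, `conjV` laws, tadpole-null remainders, `conjW` laws pass to the limit -/

section Letters

/-- [folklore] **THE RELATIVE-INVERSE LETTER PASSES TO THE LIMIT.**  `RelInv (A j) (M j) E` at every `j` (`E` fixed: the projector), `A j → A∞`,
`M j → M∞` at geometric `Decays`-rates with uniform bounds ⟹ `RelInv A∞ M∞ E`. -/
theorem relInv_of_rate {A M : ℕ → MKer D F} {Ainf Minf E : MKer D F} {CA CM CE CAi CMi cA cM δ θ : ℝ}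
    (hR : ∀ j, RelInv (A j) (M j) E) (hA : ∀ j, Decays (A j) CA δ) (hM : ∀ j, Decays (M j) CM δ) (hE : Decays E CE δ)
    (hAinf : Decays Ainf CAi δ) (hMinf : Decays Minf CMi δ)
    (hAr : ∀ j, Decays (A j - Ainf) (cA * θ ^ j) δ) (hMr : ∀ j, Decays (M j - Minf) (cM * θ ^ j) δ)
    (hδ : 0 < δ) (hθ0 : 0 ≤ θ) (hθ1 : θ < 1) : RelInv Ainf Minf E := by
  have hEr : ∀ j : ℕ, Decays ((fun _ : ℕ => E) j - E) (0 * θ ^ j) δ := decays_rate_const E δ θ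
  have tA : ∀ x y a b, Tendsto (fun j => A j x y a b) atTop (𝓝 (Ainf x y a b)) := tendsto_of_decays_rate hAr hθ0 hθ1
  have tE : ∀ x y a b, Tendsto (fun _ : ℕ => E x y a b) atTop (𝓝 (E x y a b)) := fun _ _ _ _ => tendsto_const_nhds
  refine ⟨?_, ?_, ?_, ?_⟩
  · exact eq_of_tendsto_of_eq (K := fun j => comp E (A j)) (L := A) (fun j => (hR j).1)
      (tendsto_comp_of_rate (A := fun _ => E) (fun _ => hE) hAinf hEr hAr hδ hθ0 hθ1) tA
  · exact eq_of_tendsto_of_eq (K := fun j => comp (A j) E) (L := A) (fun j => (hR j).2.1)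
      (tendsto_comp_of_rate (B := fun _ => E) hA hE hAr hEr hδ hθ0 hθ1) tA
  · exact eq_of_tendsto_of_eq (K := fun j => comp (comp (A j) (M j)) E) (L := fun _ => E) (fun j => (hR j).2.2.1)
      (tendsto_comp₃_of_rate (Z := fun _ => E) hA hM (fun _ => hE) hMinf hE hAr hMr hEr hδ hθ0 hθ1) tE
  · exact eq_of_tendsto_of_eq (K := fun j => comp (comp E (M j)) (A j)) (L := fun _ => E) (fun j => (hR j).2.2.2)
      (tendsto_comp₃_of_rate (X := fun _ => E) (fun _ => hE) hM hA hMinf hAinf hEr hMr hAr hδ hθ0 hθ1) tE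

/-- [folklore] **ENTRYWISE CONVERGENCE OF `conjV`** from rate data of the chart operator `M` and the generator `X`. -/
theorem tendsto_conjV_of_rate {M X : ℕ → MKer D F} {Minf Xinf : MKer D F} {CM CX CMi CXi cM cX δ θ : ℝ}
    (hM : ∀ j, Decays (M j) CM δ) (hX : ∀ j, Decays (X j) CX δ) (hMinf : Decays Minf CMi δ) (hXinf : Decays Xinf CXi δ)
    (hMr : ∀ j, Decays (M j - Minf) (cM * θ ^ j) δ) (hXr : ∀ j, Decays (X j - Xinf) (cX * θ ^ j) δ)
    (hδ : 0 < δ) (hθ0 : 0 ≤ θ) (hθ1 : θ < 1) (x y : Fin D → ℤ) (a b : F) :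
    Tendsto (fun j => conjV (M j) (X j) x y a b) atTop (𝓝 (conjV Minf Xinf x y a b)) := by
  simp only [ChartConjugation.conjV, Pi.sub_apply]
  exact (tendsto_comp_of_rate hM hXinf hMr hXr hδ hθ0 hθ1 x y a b).sub (tendsto_comp_of_rate hX hMinf hXr hMr hδ hθ0 hθ1 x y a b)

/-- [folklore] **A `conjV`-LAW PASSES TO THE LIMIT**: `L j = conjV (M j) (X j)` at every `j`, `L j → L∞` entrywise, rate data for `M`, `X`
⟹ `L∞ = conjV M∞ X∞`.  (The shape of (W1′) and of the block-stencil Ward law.) -/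
theorem law_conjV_of_rate {L M X : ℕ → MKer D F} {Linf Minf Xinf : MKer D F} {CM CX CMi CXi cM cX δ θ : ℝ}
    (hlaw : ∀ j, L j = conjV (M j) (X j)) (hL : ∀ x y a b, Tendsto (fun j => L j x y a b) atTop (𝓝 (Linf x y a b)))
    (hM : ∀ j, Decays (M j) CM δ) (hX : ∀ j, Decays (X j) CX δ) (hMinf : Decays Minf CMi δ) (hXinf : Decays Xinf CXi δ)
    (hMr : ∀ j, Decays (M j - Minf) (cM * θ ^ j) δ) (hXr : ∀ j, Decays (X j - Xinf) (cX * θ ^ j) δ)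
    (hδ : 0 < δ) (hθ0 : 0 ≤ θ) (hθ1 : θ < 1) : Linf = conjV Minf Xinf :=
  eq_of_tendsto_of_eq (L := fun j => conjV (M j) (X j)) hlaw hL (tendsto_conjV_of_rate hM hX hMinf hXinf hMr hXr hδ hθ0 hθ1)

omit [Fintype F] in
/-- [folklore] Entrywise convergence of the pure-gauge vertex `KernelWard.divV (S j) u` from entrywise convergence of the stencil family. -/
theorem tendsto_divV {S : ℕ → Fin D → (Fin D → ℤ) → MKer D F} {Sinf : Fin D → (Fin D → ℤ) → MKer D F}
    (hS : ∀ κ u x z a b, Tendsto (fun j => S j κ u x z a b) atTop (𝓝 (Sinf κ u x z a b))) (u x z : Fin D → ℤ) (a b : F) :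
    Tendsto (fun j => KernelWard.divV (S j) u x z a b) atTop (𝓝 (KernelWard.divV Sinf u x z a b)) := by
  simp only [KernelWard.divV, Finset.sum_apply, Pi.sub_apply]
  exact tendsto_finsetSum _ fun μ _ => (hS μ _ x z a b).sub (hS μ u x z a b)

omit [Fintype F] in
/-- [folklore] Entrywise convergence of the BLOCK pure-gauge vertex `c j • Σ_{v ∈ T} divV (S j) (w v)`. -/
theorem tendsto_smul_sum_divV {S : ℕ → Fin D → (Fin D → ℤ) → MKer D F} {Sinf : Fin D → (Fin D → ℤ) → MKer D F}
    (hS : ∀ κ u x z a b, Tendsto (fun j => S j κ u x z a b) atTop (𝓝 (Sinf κ u x z a b))) {c : ℕ → ℝ} {cinf : ℝ}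
    (hc : Tendsto c atTop (𝓝 cinf)) {ι : Type*} (T : Finset ι) (w : ι → (Fin D → ℤ)) (x z : Fin D → ℤ) (a b : F) :
    Tendsto (fun j => (c j • ∑ v ∈ T, KernelWard.divV (S j) (w v)) x z a b) atTop
      (𝓝 ((cinf • ∑ v ∈ T, KernelWard.divV Sinf (w v)) x z a b)) := by
  simp only [Pi.smul_apply, Finset.sum_apply, smul_eq_mul]
  exact hc.mul (tendsto_finsetSum _ fun v _ => tendsto_divV hS (w v) x z a b)

/-- [folklore] **THE BLOCK-STENCIL WARD LETTER PASSES TO THE LIMIT** (letter (S) of `FP/PerfectFineWard`, an1's `hSd` ∕ leaf-10's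
`WardLocusRecursive.hSd_SrecAt` shape): `c j • Σ_{v ∈ T} divV (S j) (w v) = conjV (M j) (X j)` at every `j`, stencils converging entrywise,
`c j → c∞`, rate data for `M j → M∞`, `X j → X∞` ⟹ `c∞ • Σ_{v ∈ T} divV S∞ (w v) = conjV M∞ X∞`. -/
theorem blockWard_of_rate {S : ℕ → Fin D → (Fin D → ℤ) → MKer D F} {Sinf : Fin D → (Fin D → ℤ) → MKer D F}
    {M X : ℕ → MKer D F} {Minf Xinf : MKer D F} {c : ℕ → ℝ} {cinf CM CX CMi CXi cM cX δ θ : ℝ} {ι : Type*} (T : Finset ι)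
    (w : ι → (Fin D → ℤ)) (hlaw : ∀ j, c j • ∑ v ∈ T, KernelWard.divV (S j) (w v) = conjV (M j) (X j))
    (hS : ∀ κ u x z a b, Tendsto (fun j => S j κ u x z a b) atTop (𝓝 (Sinf κ u x z a b))) (hc : Tendsto c atTop (𝓝 cinf))
    (hM : ∀ j, Decays (M j) CM δ) (hX : ∀ j, Decays (X j) CX δ) (hMinf : Decays Minf CMi δ) (hXinf : Decays Xinf CXi δ)
    (hMr : ∀ j, Decays (M j - Minf) (cM * θ ^ j) δ) (hXr : ∀ j, Decays (X j - Xinf) (cX * θ ^ j) δ)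
    (hδ : 0 < δ) (hθ0 : 0 ≤ θ) (hθ1 : θ < 1) :
    cinf • ∑ v ∈ T, KernelWard.divV Sinf (w v) = conjV Minf Xinf :=
  law_conjV_of_rate (L := fun j => c j • ∑ v ∈ T, KernelWard.divV (S j) (w v)) hlaw (tendsto_smul_sum_divV hS hc T w)
    hM hX hMinf hXinf hMr hXr hδ hθ0 hθ1

/-- [folklore] Homogeneity of the tadpole-channel Lipschitz constant in the two deviations. -/
theorem lipT_mul (cF δ C' Cw εA εW t : ℝ) :
    HessKerRate.lipT D cF δ C' Cw (εA * t) (εW * t) = t * HessKerRate.lipT D cF δ C' Cw εA εW := by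
  unfold HessKerRate.lipT
  ring

/-- [folklore] **A TADPOLE-NULL REMAINDER STAYS TADPOLE-NULL IN THE LIMIT**: `tadpole (A j) (N j) = 0` at every `j`, `A j → A∞` at a
`Decays`-rate, `N j → N∞` at a `BiLoc`-rate at `(p, q)` with uniform bounds ⟹ `tadpole A∞ N∞ = 0` (`HessKerRate.abs_tadpole_sub_le`). -/
theorem tadpoleNull_of_rate {A N : ℕ → MKer D F} {Ainf Ninf : MKer D F} {p q : Fin D → ℤ} {CA CAi CN CNi cA cN δ θ : ℝ}
    (h0 : ∀ j, tadpole (A j) (N j) = 0) (hA : ∀ j, Decays (A j) CA δ) (hAinf : Decays Ainf CAi δ)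
    (hN : ∀ j, BiLoc (N j) p q CN δ) (hNinf : BiLoc Ninf p q CNi δ)
    (hAr : ∀ j, Decays (A j - Ainf) (cA * θ ^ j) δ) (hNr : ∀ j, BiLoc (N j - Ninf) p q (cN * θ ^ j) δ)
    (hδ : 0 < δ) (hθ0 : 0 ≤ θ) (hθ1 : θ < 1) : tadpole Ainf Ninf = 0 := by
  -- `|tadpole A∞ N∞| ≤ θ^j · L` for every `j`
  have hb : ∀ j : ℕ, |tadpole Ainf Ninf| ≤ θ ^ j * HessKerRate.lipT D (Fintype.card F) δ CAi CN cA cN := by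
    intro j
    have h := HessKerRate.abs_tadpole_sub_le (hA j) hAinf (hAr j) (hN j) hNinf (hNr j) hδ
    rw [h0 j, zero_sub, abs_neg, lipT_mul] at h
    have hL : 0 ≤ θ ^ j * HessKerRate.lipT D (Fintype.card F) δ CAi CN cA cN := by
      by_contra hneg
      have hlt := mul_neg_of_neg_of_pos (lt_of_not_ge hneg) (Real.exp_pos (-(δ / 2 / 2) * l1 (p - q)))
      linarith [abs_nonneg (tadpole Ainf Ninf)]
    refine h.trans ?_
    calc θ ^ j * HessKerRate.lipT D (Fintype.card F) δ CAi CN cA cN * Real.exp (-(δ / 2 / 2) * l1 (p - q))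
        ≤ θ ^ j * HessKerRate.lipT D (Fintype.card F) δ CAi CN cA cN * 1 :=
          mul_le_mul_of_nonneg_left (by rw [Real.exp_le_one_iff]; nlinarith [l1_nonneg (p - q)]) hL
      _ = _ := mul_one _
  -- `θ^j · L → 0`
  have ht : Tendsto (fun j : ℕ => θ ^ j * HessKerRate.lipT D (Fintype.card F) δ CAi CN cA cN) atTop (𝓝 0) := by
    simpa using (tendsto_pow_atTop_nhds_zero_of_lt_one hθ0 hθ1).mul_const (HessKerRate.lipT D (Fintype.card F) δ CAi CN cA cN)
  have hle : |tadpole Ainf Ninf| ≤ 0 := ge_of_tendsto' ht hb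
  exact abs_eq_zero.1 (le_antisymm hle (abs_nonneg _))

/-- [folklore] **ENTRYWISE CONVERGENCE OF THE SECOND-ORDER CONTACT `conjW`** from rate data of its six letters (all decaying at rate `δ`,
geometric rates `θ^j`). -/
theorem tendsto_conjW_of_rate {M V Vp X Xp X₂ : ℕ → MKer D F} {Minf Vinf Vpinf Xinf Xpinf X₂inf : MKer D F}
    {CM CV CVp CX CXp CX₂ CMi CVi CVpi CXi CXpi CX₂i cM cV cVp cX cXp cX₂ δ θ : ℝ}
    (hM : ∀ j, Decays (M j) CM δ) (hV : ∀ j, Decays (V j) CV δ) (hVp : ∀ j, Decays (Vp j) CVp δ) (hX : ∀ j, Decays (X j) CX δ)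
    (hXp : ∀ j, Decays (Xp j) CXp δ) (hX₂ : ∀ j, Decays (X₂ j) CX₂ δ)
    (hMinf : Decays Minf CMi δ) (hVinf : Decays Vinf CVi δ) (hVpinf : Decays Vpinf CVpi δ) (hXinf : Decays Xinf CXi δ)
    (hXpinf : Decays Xpinf CXpi δ) (hX₂inf : Decays X₂inf CX₂i δ)
    (hMr : ∀ j, Decays (M j - Minf) (cM * θ ^ j) δ) (hVr : ∀ j, Decays (V j - Vinf) (cV * θ ^ j) δ)
    (hVpr : ∀ j, Decays (Vp j - Vpinf) (cVp * θ ^ j) δ) (hXr : ∀ j, Decays (X j - Xinf) (cX * θ ^ j) δ)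
    (hXpr : ∀ j, Decays (Xp j - Xpinf) (cXp * θ ^ j) δ) (hX₂r : ∀ j, Decays (X₂ j - X₂inf) (cX₂ * θ ^ j) δ)
    (hδ : 0 < δ) (hθ0 : 0 ≤ θ) (hθ1 : θ < 1) (x y : Fin D → ℤ) (a b : F) :
    Tendsto (fun j => conjW (M j) (V j) (Vp j) (X j) (Xp j) (X₂ j) x y a b) atTop
      (𝓝 (conjW Minf Vinf Vpinf Xinf Xpinf X₂inf x y a b)) := by
  simp only [ChartConjugation.conjW, ChartConjugation.conjW₁, ChartConjugation.conjW₂, Pi.add_apply, Pi.sub_apply]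
  refine (((tendsto_comp_of_rate hVp hXinf hVpr hXr hδ hθ0 hθ1 x y a b).sub
      (tendsto_comp_of_rate hX hVpinf hXr hVpr hδ hθ0 hθ1 x y a b)).add
    ((tendsto_comp_of_rate hV hXpinf hVr hXpr hδ hθ0 hθ1 x y a b).sub
      (tendsto_comp_of_rate hXp hVinf hXpr hVr hδ hθ0 hθ1 x y a b))).add ?_
  refine (((tendsto_comp₃_of_rate hX hXp hM hXpinf hMinf hXr hXpr hMr hδ hθ0 hθ1 x y a b).add
      (tendsto_comp₃_of_rate hXp hX hM hXinf hMinf hXpr hXr hMr hδ hθ0 hθ1 x y a b)).sub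
    ((tendsto_comp₃_of_rate hX hM hXp hMinf hXpinf hXr hMr hXpr hδ hθ0 hθ1 x y a b).add
      (tendsto_comp₃_of_rate hXp hM hX hMinf hXinf hXpr hMr hXr hδ hθ0 hθ1 x y a b))).add ?_
  exact (tendsto_comp_of_rate hM hX₂inf hMr hX₂r hδ hθ0 hθ1 x y a b).sub (tendsto_comp_of_rate hX₂ hMinf hX₂r hMr hδ hθ0 hθ1 x y a b)

/-- [folklore] **A SECOND-ORDER LAW (W2♮) PASSES TO THE LIMIT**: `L j = conjW (M j) (V j) (V′ j) (X j) (X′ j) (X₂ j) + N j` at every `j`,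
`L j → L∞` and `N j → N∞` entrywise, rate data for the six contact letters ⟹ `L∞ = conjW M∞ V∞ V′∞ X∞ X′∞ X₂∞ + N∞`. -/
theorem law_conjW_of_rate {L N M V Vp X Xp X₂ : ℕ → MKer D F} {Linf Ninf Minf Vinf Vpinf Xinf Xpinf X₂inf : MKer D F}
    {CM CV CVp CX CXp CX₂ CMi CVi CVpi CXi CXpi CX₂i cM cV cVp cX cXp cX₂ δ θ : ℝ}
    (hlaw : ∀ j, L j = conjW (M j) (V j) (Vp j) (X j) (Xp j) (X₂ j) + N j)
    (hL : ∀ x y a b, Tendsto (fun j => L j x y a b) atTop (𝓝 (Linf x y a b)))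
    (hN : ∀ x y a b, Tendsto (fun j => N j x y a b) atTop (𝓝 (Ninf x y a b)))
    (hM : ∀ j, Decays (M j) CM δ) (hV : ∀ j, Decays (V j) CV δ) (hVp : ∀ j, Decays (Vp j) CVp δ) (hX : ∀ j, Decays (X j) CX δ)
    (hXp : ∀ j, Decays (Xp j) CXp δ) (hX₂ : ∀ j, Decays (X₂ j) CX₂ δ)
    (hMinf : Decays Minf CMi δ) (hVinf : Decays Vinf CVi δ) (hVpinf : Decays Vpinf CVpi δ) (hXinf : Decays Xinf CXi δ)
    (hXpinf : Decays Xpinf CXpi δ) (hX₂inf : Decays X₂inf CX₂i δ)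
    (hMr : ∀ j, Decays (M j - Minf) (cM * θ ^ j) δ) (hVr : ∀ j, Decays (V j - Vinf) (cV * θ ^ j) δ)
    (hVpr : ∀ j, Decays (Vp j - Vpinf) (cVp * θ ^ j) δ) (hXr : ∀ j, Decays (X j - Xinf) (cX * θ ^ j) δ)
    (hXpr : ∀ j, Decays (Xp j - Xpinf) (cXp * θ ^ j) δ) (hX₂r : ∀ j, Decays (X₂ j - X₂inf) (cX₂ * θ ^ j) δ)
    (hδ : 0 < δ) (hθ0 : 0 ≤ θ) (hθ1 : θ < 1) :
    Linf = conjW Minf Vinf Vpinf Xinf Xpinf X₂inf + Ninf :=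
  eq_of_tendsto_of_eq (L := fun j => conjW (M j) (V j) (Vp j) (X j) (Xp j) (X₂ j) + N j) hlaw hL fun x y a b => by
    simp only [Pi.add_apply]
    exact (tendsto_conjW_of_rate hM hV hVp hX hXp hX₂ hMinf hVinf hVpinf hXinf hXpinf hX₂inf hMr hVr hVpr hXr hXpr hX₂r hδ hθ0 hθ1
      x y a b).add (hN x y a b)

end Letters

end Summit.QuantumFields.BalabanUV.Beta.FP.LetterInheritance

end
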